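import Summits.Ventures.HodgeRepro2.T5SU11PhaseTail

/-!
# The tail of the Cartan coordinate: `P_k(t(g) > τ) = cosh(τ)^{−(k−2)}`

The phase is `log|a(g)| = log cosh t(g)` with `t(g) ≥ 0` the Cartan coordinate
(`T5SU11CartanProjection.cosh_cartanT`), and `cosh` is strictly increasing on `[0, ∞)`, so the event
`{t(g) > τ}` is the event `{log|a(g)| > log cosh τ}` and the tail of `T5SU11PhaseTail` reads

  **`∫⁻_{t(g) > τ} (1 − |g·0|²)^{k/2} dν = 2π cosh(τ)^{−(k−2)}/(k − 2)`,   `P_k(t(g) > τ) = cosh(τ)^{−(k−2)}`**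

(`lintegral_cartan_tail`, `cartan_tail_prob`, `k > 2`, `τ ≥ 0`); for the weight `3` of the owner's model,
`P_3(t > τ) = 1/cosh τ` (`cartan_tail_prob_three`); the quantiles of the phase are `log(1/p)/(k − 2)`
and its median `log 2/(k − 2)` (`phase_quantile`, `phase_median`). Nothing is claimed about (N).

Blind lane: Mathlib + the HodgeRepro2 prefix only; no sorry; axioms ⊆ {propext, Classical.choice,
Quot.sound}.
-/

namespace Summit.Ventures.HodgeRepro2.T5SU11PhaseTailCartan

open MeasureTheory MeasureTheory.Measure Metric Set Filter Topology
open T5SU11Unimodular T5SU11Fibration T5SU11Cartan T5SU11CartanProjection T5HaarCircle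
  T5BergmanCoefficient T5SU11FibrationHaar T5SU11JacobiWeight T5SU11PhaseLaw T5SU11PhaseLawLintegral
  T5SU11PhaseTail
open scoped Real ENNReal

/-- `{t(g) > τ} = {log|a(g)| > log cosh τ}` for `τ ≥ 0`. -/
lemma setOf_cartanT_gt_eq {τ : ℝ} (hτ : 0 ≤ τ) :
    {g : SU11 | τ < cartanT g} = {g : SU11 | Real.log (Real.cosh τ) < Real.log ‖mat g 0 0‖} := by
  ext g
  simp only [mem_setOf_eq]
  rw [← cosh_cartanT g, Real.log_lt_log_iff (Real.cosh_pos τ) (Real.cosh_pos _)]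
  constructor
  · intro h
    exact Real.cosh_strictMonoOn (mem_Ici.mpr hτ) (mem_Ici.mpr (cartanT_nonneg g)) h
  · intro h
    by_contra hle
    have hle' : cartanT g ≤ τ := not_lt.mp hle
    exact absurd h (not_lt.mpr (Real.cosh_strictMonoOn.monotoneOn (mem_Ici.mpr (cartanT_nonneg g))
      (mem_Ici.mpr hτ) hle'))

section measure

variable [MeasurableSpace Circle] [BorelSpace Circle]

/-- **The tail of the Cartan coordinate**: for `k > 2`, `τ ≥ 0`,
`∫⁻_{t(g) > τ} (1 − |g·0|²)^{k/2} dν = 2π cosh(τ)^{−(k−2)}/(k − 2)`. -/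
theorem lintegral_cartan_tail {k τ : ℝ} (hk : 2 < k) (hτ : 0 ≤ τ) :
    ∫⁻ g, {g : SU11 | τ < cartanT g}.indicator
        (fun g => ENNReal.ofReal ((1 - ‖orbit g‖ ^ 2) ^ (k / 2))) g ∂(nu haarCircle)
      = ENNReal.ofReal (2 * π * Real.cosh τ ^ (-(k - 2)) / (k - 2)) := by
  rw [setOf_cartanT_gt_eq hτ, lintegral_phase_tail hk (Real.log_nonneg (Real.one_le_cosh τ))]
  congr 2
  rw [Real.rpow_def_of_pos (Real.cosh_pos τ)]
  ring_nf

/-- **`P_k(t(g) > τ) = cosh(τ)^{−(k−2)}`.** -/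
theorem cartan_tail_prob {k τ : ℝ} (hk : 2 < k) (hτ : 0 ≤ τ) :
    (∫⁻ g, {g : SU11 | τ < cartanT g}.indicator
        (fun g => ENNReal.ofReal ((1 - ‖orbit g‖ ^ 2) ^ (k / 2))) g ∂(nu haarCircle))
      / ENNReal.ofReal (2 * π / (k - 2)) = ENNReal.ofReal (Real.cosh τ ^ (-(k - 2))) := by
  rw [setOf_cartanT_gt_eq hτ, phase_tail_prob hk (Real.log_nonneg (Real.one_le_cosh τ))]
  congr 1
  rw [Real.rpow_def_of_pos (Real.cosh_pos τ)]
  ring_nf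

/-- **Weight `3`**: `P_3(t(g) > τ) = 1/cosh τ`. -/
theorem cartan_tail_prob_three {τ : ℝ} (hτ : 0 ≤ τ) :
    (∫⁻ g, {g : SU11 | τ < cartanT g}.indicator
        (fun g => ENNReal.ofReal ((1 - ‖orbit g‖ ^ 2) ^ ((3 : ℝ) / 2))) g ∂(nu haarCircle))
      / ENNReal.ofReal (2 * π / (3 - 2)) = ENNReal.ofReal (Real.cosh τ)⁻¹ := by
  rw [cartan_tail_prob (by norm_num) hτ, show (-((3 : ℝ) - 2)) = -1 by norm_num, Real.rpow_neg_one,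
    ENNReal.ofReal_inv_of_pos (Real.cosh_pos τ)]

/-- **The quantiles of the phase**: `P_k(log|a| > log(1/p)/(k − 2)) = p` for `0 < p ≤ 1`; in particular
the median of the phase is `log 2/(k − 2)`. -/
theorem phase_quantile {k p : ℝ} (hk : 2 < k) (hp0 : 0 < p) (hp1 : p ≤ 1) :
    (∫⁻ g, {g : SU11 | Real.log (1 / p) / (k - 2) < Real.log ‖mat g 0 0‖}.indicator
        (fun g => ENNReal.ofReal ((1 - ‖orbit g‖ ^ 2) ^ (k / 2))) g ∂(nu haarCircle))
      / ENNReal.ofReal (2 * π / (k - 2)) = ENNReal.ofReal p := by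
  have hk2 : 0 < k - 2 := by linarith
  have hx : 0 ≤ Real.log (1 / p) / (k - 2) :=
    div_nonneg (Real.log_nonneg (by rw [le_div_iff₀ hp0]; linarith)) hk2.le
  rw [phase_tail_prob hk hx]
  congr 1
  rw [show -((k - 2) * (Real.log (1 / p) / (k - 2))) = -Real.log (1 / p) by field_simp,
    Real.exp_neg, Real.exp_log (by positivity), one_div, inv_inv]

/-- The median of the phase is `log 2/(k − 2)`. -/
theorem phase_median {k : ℝ} (hk : 2 < k) :
    (∫⁻ g, {g : SU11 | Real.log 2 / (k - 2) < Real.log ‖mat g 0 0‖}.indicator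
        (fun g => ENNReal.ofReal ((1 - ‖orbit g‖ ^ 2) ^ (k / 2))) g ∂(nu haarCircle))
      / ENNReal.ofReal (2 * π / (k - 2)) = ENNReal.ofReal (1 / 2) := by
  have h := phase_quantile hk (p := 1 / 2) (by norm_num) (by norm_num)
  rwa [one_div_one_div] at h

end measure

end Summit.Ventures.HodgeRepro2.T5SU11PhaseTailCartan
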